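import Literature.Dynamics.Tilings.OllingerAperiodic
import Literature.Dynamics.Tilings.OllingerWindows
import Mathlib.Data.Nat.Log
import Mathlib.Tactic.Positivity
import HarnessLib

/-!
# The Ollinger subshift is linearly net gluing

The gluing input of Gangloff–Sablik's Theorem 26 (`GangloffSablik2021_aperiodic`), with the
Ollinger subshift (`OllingerSFT.lean`, aperiodic by `OllingerAperiodic.lean`) in place of the
Robinson subshift of Gangloff–Sablik §3–§4.3: **for every `m ≥ 1` there is `N ≤ 512 m` such that
any two `m`-blocks of any two tilings occur together in ONE tiling, at all relative positions of
a coset `w + N ℤ²`** (`ollinger_netGluing`; Gangloff–Sablik Def. 13 "`f`-net gluing" with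
`f` linear, in the strong form where one configuration serves all lattice vectors).

The proof is the global hierarchy of tilings:

* `hierarchy` — iterating the decomposition "`τ` codes `s`", every tiling is, up to a translation
  `U ∈ [0, 2^c)²`, the grid of the supertiles of order `c` of the cells of a tiling:
  `x (U + 2^c z + ρ) = S^c(x_c z)[ρ]`;
* `window_of_tiling` — every `2 × 2` window of a tiling is a window of `S^6(x*)` (the four forms
  of `OllingerWindows.lean`);
* `block_in_supertile` — hence an `m`-block of a tiling, `m ≤ 2^c`, which lies in the supertiles
  of a `2 × 2` window of `x_c`, is a translate of a window of the single supertile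
  `S^{c+6}(x*)` (`cellS_add`: `S^{c+6} = S^c ∘ S^6`);
* `supertile_everywhere` — `S^k(x*)` occurs in EVERY tiling on the lattice coset
  `V + 2^{k+2} ℤ²` (the cell `(3,3)` of `S^2(b)` is `x*` for every tile `b`);
* `ollinger_netGluing` — shift a tiling so that a copy of `S^{c+6}(x*)` puts the first block at
  the origin; the other copies carry the second block at `w + 2^{c+8} ℤ²`.

## References

* S. Gangloff, M. Sablik, *Quantified block gluing for multidimensional subshifts of finite type:
  aperiodicity and entropy*, J. Anal. Math. 144 (2021), Def. 13 and §4.3 (arXiv:1706.01627).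
* N. Ollinger, *Two-by-Two Substitution Systems and the Undecidability of the Domino Problem*,
  CiE 2008, LNCS 5028, doi:10.1007/978-3-540-69407-6_51, §1 (histories) and §3.
-/

namespace Literature.Dynamics.Tilings.Ollinger

open Tile
open Literature.Dynamics.SymbolicDynamics (IsSFT IsAperiodic square mem_square)
open _root_.SymbolicDynamics.FullShift

/-! ### Composition of supertiles -/

/-- [folklore] -/
theorem bit_two_mul_add (K ρ : ℕ) : bit (2 * K + ρ) = bit ρ := by
  unfold bit
  congr 1
  simp only [eq_iff_iff]
  omega

/-- **`S^{c+k} = S^c ∘ S^k`**: the cell `2^c (I, J) + ρ` of `S^{c+k}(t)` is the cell `ρ` of the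
supertile of order `c` of the cell `(I, J)` of `S^k(t)`. [cite: Ollinger2008, §1] -/
theorem cellS_add (c k : ℕ) (t : Tile) (I J : ℕ) {ρ₁ ρ₂ : ℕ} (h1 : ρ₁ < 2 ^ c) (h2 : ρ₂ < 2 ^ c) :
    cellS (c + k) t (2 ^ c * I + ρ₁) (2 ^ c * J + ρ₂) = cellS c (cellS k t I J) ρ₁ ρ₂ := by
  induction c generalizing ρ₁ ρ₂ with
  | zero =>
    have e1 : ρ₁ = 0 := by simpa using h1
    have e2 : ρ₂ = 0 := by simpa using h2
    subst e1 e2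
    simp
  | succ c ih =>
    have h2c : (2 : ℕ) ^ (c + 1) = 2 * 2 ^ c := by ring
    rw [show c + 1 + k = (c + k) + 1 by ring, cellS_succ, cellS_succ c,
      show 2 ^ (c + 1) * I + ρ₁ = 2 * (2 ^ c * I) + ρ₁ by ring,
      show 2 ^ (c + 1) * J + ρ₂ = 2 * (2 ^ c * J) + ρ₂ by ring, bit_two_mul_add, bit_two_mul_add,
      show (2 * (2 ^ c * I) + ρ₁) / 2 = 2 ^ c * I + ρ₁ / 2 by omega,
      show (2 * (2 ^ c * J) + ρ₂) / 2 = 2 ^ c * J + ρ₂ / 2 by omega,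
      ih (by omega) (by omega)]

/-- The cell `(3, 3)` of `S^2(b)` is the corner tile `x*`, for every tile `b`.
[cite: Ollinger2008, §3] -/
theorem cellS_two_three_three (b : Tile) : cellS 2 b 3 3 = xstar := by
  rfl

/-! ### The hierarchy of a tiling -/

section Hierarchy

variable {x : ℤ × ℤ → GoodTile}

/-- **The global hierarchy**: for every `c`, a tiling is, up to a translation `U ∈ [0, 2^c)²`, the
grid of the supertiles of order `c` of the cells of a tiling `y` (its `c`-fold decoding):
`x (U + 2^c z + ρ) = S^c(y z)[ρ]` for `ρ ∈ [0, 2^c)²` ("an history for a coloring", Ollinger §1;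
here every tiling has one, Thm. 1). [cite: Ollinger2008, §1 and §3 (proof of Thm. 1)] -/
theorem hierarchy (hx : IsOTiling x) (c : ℕ) :
    ∃ U : ℤ × ℤ, (0 ≤ U.1 ∧ U.1 < 2 ^ c ∧ 0 ≤ U.2 ∧ U.2 < 2 ^ c) ∧
      ∃ y : ℤ × ℤ → GoodTile, IsOTiling y ∧ ∀ (z : ℤ × ℤ) (ρ₁ ρ₂ : ℕ), ρ₁ < 2 ^ c → ρ₂ < 2 ^ c →
        (x (U.1 + 2 ^ c * z.1 + ρ₁, U.2 + 2 ^ c * z.2 + ρ₂)).1 = cellS c (y z).1 ρ₁ ρ₂ := by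
  induction c with
  | zero =>
    refine ⟨0, by simp, x, hx, fun z ρ₁ ρ₂ h1 h2 => ?_⟩
    have e1 : ρ₁ = 0 := by simpa using h1
    have e2 : ρ₂ = 0 := by simpa using h2
    subst e1 e2
    simp
  | succ c ih =>
    obtain ⟨U, ⟨hU1, hU2, hU3, hU4⟩, y, hy, hxy⟩ := ih
    obtain ⟨y', hy', hdec⟩ := decompose hy
    obtain ⟨hb1, hb2⟩ := basePt_mem y
    have hpow : (2 : ℤ) ^ (c + 1) = 2 * 2 ^ c := by ring
    refine ⟨(U.1 + 2 ^ c * (basePt y).1, U.2 + 2 ^ c * (basePt y).2), ⟨?_, ?_, ?_, ?_⟩, y', hy', ?_⟩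
    · rcases hb1 with h | h <;> rw [h] <;> positivity
    · rcases hb1 with h | h <;> rw [h] <;> linarith [pow_pos (show (0 : ℤ) < 2 by norm_num) c]
    · rcases hb2 with h | h <;> rw [h] <;> positivity
    · rcases hb2 with h | h <;> rw [h] <;> linarith [pow_pos (show (0 : ℤ) < 2 by norm_num) c]
    -- cells of the new grid, by quadrant
    have key : ∀ (z : ℤ × ℤ) (r : B2) (ρ₁ ρ₂ : ℕ), ρ₁ < 2 ^ c → ρ₂ < 2 ^ c →
        (x (U.1 + 2 ^ c * (basePt y).1 + 2 ^ (c + 1) * z.1 + ((qoff r.1 (2 ^ c) + ρ₁ : ℕ) : ℤ),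
            U.2 + 2 ^ c * (basePt y).2 + 2 ^ (c + 1) * z.2 + ((qoff r.2 (2 ^ c) + ρ₂ : ℕ) : ℤ))).1 =
          cellS (c + 1) (y' z).1 (qoff r.1 (2 ^ c) + ρ₁) (qoff r.2 (2 ^ c) + ρ₂) := by
      intro z r ρ₁ ρ₂ h1 h2
      rw [cellS_succ_quadrant c _ r h1 h2, ← substG_val, ← hdec z r,
        ← hxy (bpos (basePt y) z r) ρ₁ ρ₂ h1 h2]
      congr 2
      obtain ⟨r1, r2⟩ := r
      unfold bpos
      refine Prod.ext ?_ ?_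
      · cases r1 <;> simp [bz, qoff] <;> ring
      · cases r2 <;> simp [bz, qoff] <;> ring
    intro z ρ₁ ρ₂ h1 h2
    -- split `ρ` into quadrant and offset
    have hq : ∀ ρ : ℕ, ρ < 2 ^ (c + 1) → ∃ (b : Bool) (ρ' : ℕ), ρ' < 2 ^ c ∧ ρ = qoff b (2 ^ c) + ρ' := by
      intro ρ hρ
      have h2c : (2 : ℕ) ^ (c + 1) = 2 * 2 ^ c := by ring
      by_cases hle : 2 ^ c ≤ ρ
      · exact ⟨true, ρ - 2 ^ c, by omega, by simp; omega⟩
      · exact ⟨false, ρ, by omega, by simp⟩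
    obtain ⟨b1, σ₁, hs1, rfl⟩ := hq ρ₁ h1
    obtain ⟨b2, σ₂, hs2, rfl⟩ := hq ρ₂ h2
    exact key z (b1, b2) σ₁ σ₂ hs1 hs2

end Hierarchy

/-! ### Windows and blocks of a tiling inside the universal supertile -/

section Blocks

variable {x : ℤ × ℤ → GoodTile}

/-- **Every `2 × 2` window of a tiling is a window of `S^6(x*)`**: the window at `a` is of one of
the four forms of `OllingerWindows.lean`, according to the parities of `a - basePt y`.
[cite: Ollinger2008, §3] -/
theorem window_of_tiling (hy : IsOTiling x) (a : ℤ × ℤ) :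
    ∃ π : ℕ × ℕ, π.1 + 2 ≤ 64 ∧ π.2 + 2 ≤ 64 ∧
      ∀ δ : B2, (x (a.1 + bz δ.1, a.2 + bz δ.2)).1 = cellS 6 xstar (π.1 + bn δ.1) (π.2 + bn δ.2) := by
  have hdec := apply_bpos_eq_subst hy
  have htil := isOTiling_decG hy
  have hz0 : bz false = 0 := rfl
  have hz1 : bz true = 1 := rfl
  obtain ⟨z₁, h1 | h1⟩ := Int.even_or_odd' (a.1 - (basePt x).1) <;>
    obtain ⟨z₂, h2 | h2⟩ := Int.even_or_odd' (a.2 - (basePt x).2)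
  · -- form I
    obtain ⟨π, hπ1, hπ2, hπ⟩ := window_I (good_decT hy (z₁, z₂))
    refine ⟨π, hπ1, hπ2, fun δ => ?_⟩
    rw [hπ δ, ← hdec (z₁, z₂) δ]
    congr 2
    unfold bpos
    exact Prod.ext (by simp only; omega) (by simp only; omega)
  · -- form III (`a` is in the north row of a block)
    have hm : vmatch (decT x (z₁, z₂)) (decT x (z₁, z₂ + 1)) = true := (htil z₁ z₂).2
    obtain ⟨π, hπ1, hπ2, hπ⟩ := window_III (good_decT hy (z₁, z₂ + 1)) hm
    refine ⟨π, hπ1, hπ2, fun δ => ?_⟩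
    obtain ⟨δ1, _ | _⟩ := δ
    · rw [bn_false, add_zero, (hπ δ1).1, ← hdec (z₁, z₂) (δ1, true)]
      congr 2
      unfold bpos
      exact Prod.ext (by simp only; omega) (by simp only [hz0, hz1]; omega)
    · rw [bn_true, (hπ δ1).2, ← hdec (z₁, z₂ + 1) (δ1, false)]
      congr 2
      unfold bpos
      exact Prod.ext (by simp only; omega) (by simp only [hz0, hz1]; omega)
  · -- form II (`a` is in the east column of a block)
    have hm : hmatch (decT x (z₁, z₂)) (decT x (z₁ + 1, z₂)) = true := (htil z₁ z₂).1
    obtain ⟨π, hπ1, hπ2, hπ⟩ := window_II (good_decT hy (z₁ + 1, z₂)) hm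
    refine ⟨π, hπ1, hπ2, fun δ => ?_⟩
    obtain ⟨_ | _, δ2⟩ := δ
    · rw [bn_false, add_zero, (hπ δ2).1, ← hdec (z₁, z₂) (true, δ2)]
      congr 2
      unfold bpos
      exact Prod.ext (by simp only [hz0, hz1]; omega) (by simp only; omega)
    · rw [bn_true, (hπ δ2).2, ← hdec (z₁ + 1, z₂) (false, δ2)]
      congr 2
      unfold bpos
      exact Prod.ext (by simp only [hz0, hz1]; omega) (by simp only; omega)
  · -- form IV (`a` is the north-east cell of a block)
    have hab : hmatch (decT x (z₁, z₂)) (decT x (z₁ + 1, z₂)) = true := (htil z₁ z₂).1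
    have hcd : hmatch (decT x (z₁, z₂ + 1)) (decT x (z₁ + 1, z₂ + 1)) = true := (htil z₁ (z₂ + 1)).1
    have hbd : vmatch (decT x (z₁ + 1, z₂)) (decT x (z₁ + 1, z₂ + 1)) = true := (htil (z₁ + 1) z₂).2
    obtain ⟨π, hπ1, hπ2, e1, e2, e3, e4⟩ :=
      window_IV (good_decT hy (z₁ + 1, z₂ + 1)) hab hcd hbd
    refine ⟨π, hπ1, hπ2, fun δ => ?_⟩
    obtain ⟨_ | _, _ | _⟩ := δ
    · rw [bn_false, add_zero, add_zero, e1, ← hdec (z₁, z₂) (true, true)]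
      congr 2
      unfold bpos
      exact Prod.ext (by simp only [hz0, hz1]; omega) (by simp only [hz0, hz1]; omega)
    · rw [bn_false, bn_true, add_zero, e3, ← hdec (z₁, z₂ + 1) (true, false)]
      congr 2
      unfold bpos
      exact Prod.ext (by simp only [hz0, hz1]; omega) (by simp only [hz0, hz1]; omega)
    · rw [bn_true, bn_false, add_zero, e2, ← hdec (z₁ + 1, z₂) (false, true)]
      congr 2
      unfold bpos
      exact Prod.ext (by simp only [hz0, hz1]; omega) (by simp only [hz0, hz1]; omega)
    · rw [bn_true, e4, ← hdec (z₁ + 1, z₂ + 1) (false, false)]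
      congr 2
      unfold bpos
      exact Prod.ext (by simp only [hz0, hz1]; omega) (by simp only [hz0, hz1]; omega)

/-- **An `m`-block of a tiling is a translate of a window of the universal supertile
`S^{c+6}(x*)`**, `m ≤ 2^c`: the cells `[0, m)²` of `x` are the cells `K + [0, m)²` of
`S^{c+6}(x*)` (the block meets at most `2 × 2` supertiles of order `c` of the `c`-fold decoding,
whose `2 × 2` window is a window of `S^6(x*)`).
[cite: GangloffSablik2021, §4.3 (the analogous completion for Robinson)] -/
theorem block_in_supertile (hx : IsOTiling x) {m c : ℕ} (hm : m ≤ 2 ^ c) :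
    ∃ K : ℕ × ℕ, K.1 + m ≤ 2 ^ (c + 6) ∧ K.2 + m ≤ 2 ^ (c + 6) ∧
      ∀ s₁ s₂ : ℕ, s₁ < m → s₂ < m →
        (x ((s₁ : ℤ), (s₂ : ℤ))).1 = cellS (c + 6) xstar (K.1 + s₁) (K.2 + s₂) := by
  obtain ⟨U, ⟨hU1, hU2, hU3, hU4⟩, y, hy, hxy⟩ := hierarchy hx c
  have hpowz : ((2 ^ c : ℕ) : ℤ) = (2 : ℤ) ^ c := by push_cast; ring
  have hcpos : 0 < 2 ^ c := Nat.two_pow_pos c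
  -- offsets `E` and base block `z₀`
  obtain ⟨E₁, z₁, hE1, hz1⟩ : ∃ (E₁ : ℕ) (z₁ : ℤ), E₁ < 2 ^ c ∧ (E₁ : ℤ) = -U.1 - 2 ^ c * z₁ := by
    by_cases h0 : U.1 = 0
    · exact ⟨0, 0, hcpos, by rw [h0]; simp⟩
    · refine ⟨(2 ^ c - U.1).toNat, -1, ?_, ?_⟩
      · have : (((2 ^ c - U.1).toNat : ℕ) : ℤ) = 2 ^ c - U.1 := Int.toNat_of_nonneg (by linarith)
        have h0' : 0 < U.1 := lt_of_le_of_ne hU1 (Ne.symm h0)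
        exact_mod_cast (show (((2 ^ c - U.1).toNat : ℕ) : ℤ) < ((2 ^ c : ℕ) : ℤ) by
          rw [this, hpowz]; linarith)
      · rw [Int.toNat_of_nonneg (by linarith)]; ring
  obtain ⟨E₂, z₂, hE2, hz2⟩ : ∃ (E₂ : ℕ) (z₂ : ℤ), E₂ < 2 ^ c ∧ (E₂ : ℤ) = -U.2 - 2 ^ c * z₂ := by
    by_cases h0 : U.2 = 0
    · exact ⟨0, 0, hcpos, by rw [h0]; simp⟩
    · refine ⟨(2 ^ c - U.2).toNat, -1, ?_, ?_⟩
      · have : (((2 ^ c - U.2).toNat : ℕ) : ℤ) = 2 ^ c - U.2 := Int.toNat_of_nonneg (by linarith)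
        have h0' : 0 < U.2 := lt_of_le_of_ne hU3 (Ne.symm h0)
        exact_mod_cast (show (((2 ^ c - U.2).toNat : ℕ) : ℤ) < ((2 ^ c : ℕ) : ℤ) by
          rw [this, hpowz]; linarith)
      · rw [Int.toNat_of_nonneg (by linarith)]; ring
  -- the `2 × 2` window of `y` at `z₀`
  obtain ⟨π, hπ1, hπ2, hπ⟩ := window_of_tiling hy (z₁, z₂)
  refine ⟨(2 ^ c * π.1 + E₁, 2 ^ c * π.2 + E₂), ?_, ?_, fun s₁ s₂ hs1 hs2 => ?_⟩
  · have : 2 ^ (c + 6) = 2 ^ c * 64 := by ring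
    nlinarith
  · have : 2 ^ (c + 6) = 2 ^ c * 64 := by ring
    nlinarith
  -- quadrant and offset of the cell `s`
  have hq : ∀ σ E : ℕ, σ < m → E < 2 ^ c → ∃ (b : Bool) (ρ : ℕ), ρ < 2 ^ c ∧ σ + E = qoff b (2 ^ c) + ρ := by
    intro σ E hσ hE
    by_cases hle : 2 ^ c ≤ σ + E
    · exact ⟨true, σ + E - 2 ^ c, by omega, by simp only [qoff_true]; omega⟩
    · exact ⟨false, σ + E, by omega, by simp⟩
  obtain ⟨b1, ρ₁, hρ1, hsum1⟩ := hq s₁ E₁ hs1 hE1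
  obtain ⟨b2, ρ₂, hρ2, hsum2⟩ := hq s₂ E₂ hs2 hE2
  -- the cell `s` of `x` is the cell `ρ` of the supertile of `y (z₀ + b)`
  have hcell := hxy (z₁ + bz b1, z₂ + bz b2) ρ₁ ρ₂ hρ1 hρ2
  have hpos : ((U.1 + 2 ^ c * (z₁ + bz b1) + ρ₁, U.2 + 2 ^ c * (z₂ + bz b2) + ρ₂) : ℤ × ℤ) =
      ((s₁ : ℤ), (s₂ : ℤ)) := by
    have e1 : (s₁ : ℤ) + E₁ = ((qoff b1 (2 ^ c) + ρ₁ : ℕ) : ℤ) := by exact_mod_cast hsum1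
    have e2 : (s₂ : ℤ) + E₂ = ((qoff b2 (2 ^ c) + ρ₂ : ℕ) : ℤ) := by exact_mod_cast hsum2
    refine Prod.ext ?_ ?_
    · cases b1 <;> simp [bz] at e1 ⊢ <;> linarith
    · cases b2 <;> simp [bz] at e2 ⊢ <;> linarith
  rw [hpos] at hcell
  rw [hcell, show (z₁ + bz b1, z₂ + bz b2) = ((z₁, z₂).1 + bz (b1, b2).1, (z₁, z₂).2 + bz (b1, b2).2)
    from rfl, hπ (b1, b2), ← cellS_add c 6 xstar _ _ hρ1 hρ2]
  congr 1
  · cases b1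
    · simp only [bn_false, qoff_false, zero_add, add_zero] at hsum1 ⊢; omega
    · simp only [bn_true, qoff_true] at hsum1 ⊢; rw [mul_add, mul_one]; omega
  · cases b2
    · simp only [bn_false, qoff_false, zero_add, add_zero] at hsum2 ⊢; omega
    · simp only [bn_true, qoff_true] at hsum2 ⊢; rw [mul_add, mul_one]; omega

/-- **The universal supertile occurs in every tiling, on a lattice**: for every tiling `x` and
every `k` there is `V` with `x (V + 2^{k+2} z + ρ) = S^k(x*)[ρ]` for all `z ∈ ℤ²`, `ρ ∈ [0,2^k)²`
(the cell `(3,3)` of every supertile of order `2` is `x*`; compare Gangloff–Sablik Lemma 9: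
"any order `n` supertile appears periodically in the whole configuration").
[cite: GangloffSablik2021, §3.3 Lemma 9 (the analogue for Robinson)] -/
theorem supertile_everywhere (hx : IsOTiling x) (k : ℕ) :
    ∃ V : ℤ × ℤ, ∀ (z : ℤ × ℤ) (i j : ℕ), i < 2 ^ k → j < 2 ^ k →
      (x (V.1 + 2 ^ (k + 2) * z.1 + i, V.2 + 2 ^ (k + 2) * z.2 + j)).1 = cellS k xstar i j := by
  obtain ⟨U, -, y, -, hxy⟩ := hierarchy hx (k + 2)
  refine ⟨(U.1 + 3 * 2 ^ k, U.2 + 3 * 2 ^ k), fun z i j hi hj => ?_⟩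
  have h4 : (2 : ℕ) ^ (k + 2) = 2 ^ k * 4 := by ring
  have := hxy z (2 ^ k * 3 + i) (2 ^ k * 3 + j) (by omega) (by omega)
  rw [cellS_add k 2 _ 3 3 hi hj, cellS_two_three_three] at this
  rw [← this]
  congr 2
  refine Prod.ext ?_ ?_ <;> push_cast <;> ring

end Blocks

/-! ### Net gluing -/

/-- A shift of a tiling is a tiling. [folklore] -/
theorem isOTiling_shift {x : ℤ × ℤ → GoodTile} (hx : IsOTiling x) (v : ℤ × ℤ) :
    IsOTiling (shift v x) := by
  obtain ⟨v1, v2⟩ := v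
  intro i j
  simp only [shift_apply, Prod.mk_add_mk]
  have h1 := (hx (v1 + i) (v2 + j)).1
  have h2 := (hx (v1 + i) (v2 + j)).2
  rw [add_assoc] at h1 h2
  exact ⟨h1, h2⟩

/-- **The Ollinger subshift is linearly net gluing** (Gangloff–Sablik Def. 13, strong form): for
every `m ≥ 1` there is `N`, `1 ≤ N ≤ 512 m`, such that for any two tilings `x₁, x₂` there are an
offset `w` and ONE tiling `y` which agrees with `x₁` on `⟦0, m-1⟧²` and carries the `m`-block of
`x₂` at all the positions `w + N t`, `t ∈ ℤ²`. Proof: with `m ≤ 2^c < 2m`, both blocks are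
translates of windows of `S^{c+6}(x*)` (`block_in_supertile`), which occurs in `x₁` on a coset of
`2^{c+8} ℤ²` (`supertile_everywhere`); `y` is the shift of `x₁` putting one copy's window onto the
first block, `N = 2^{c+8}`. This is the property Gangloff–Sablik prove for their rigid Robinson
subshift (§4.3, `32 · id`-net gluing) and feed into Thm. 26.
[cite: GangloffSablik2021, Def. 13 and §4.3 (here for the Ollinger subshift)] -/
theorem ollinger_netGluing (m : ℕ) (hm : 1 ≤ m) : ∃ N : ℕ, 1 ≤ N ∧ N ≤ 512 * m ∧
    ∀ x₁ ∈ ollingerShift, ∀ x₂ ∈ ollingerShift, ∃ w : ℤ × ℤ, ∃ y ∈ ollingerShift,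
      (∀ s ∈ square m, y s = x₁ s) ∧
        ∀ (t : ℤ × ℤ), ∀ s ∈ square m, y (w + ((N : ℤ) * t.1, (N : ℤ) * t.2) + s) = x₂ s := by
  -- the order `c` with `m ≤ 2^c < 2m`
  set c : ℕ := Nat.log 2 m + 1 with hc
  have hmc : m ≤ 2 ^ c := (Nat.lt_pow_succ_log_self (by norm_num) m).le
  have hcm : 2 ^ c ≤ 2 * m := by
    rw [hc, pow_succ]
    have := Nat.pow_log_le_self 2 (by omega : m ≠ 0)
    omega
  refine ⟨2 ^ (c + 8), Nat.one_le_two_pow, ?_, ?_⟩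
  · have : 2 ^ (c + 8) = 2 ^ c * 256 := by ring
    omega
  intro x₁ hx₁ x₂ hx₂
  obtain ⟨K, hK1, hK2, hK⟩ := block_in_supertile hx₁ hmc
  obtain ⟨L, hL1, hL2, hL⟩ := block_in_supertile hx₂ hmc
  obtain ⟨V, hV⟩ := supertile_everywhere hx₁ (c + 6)
  refine ⟨((L.1 : ℤ) - K.1, (L.2 : ℤ) - K.2), shift (V.1 + K.1, V.2 + K.2) x₁,
    isOTiling_shift hx₁ _, ?_, ?_⟩
  · intro s hs
    rw [mem_square] at hs
    obtain ⟨a, b⟩ := s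
    simp only at hs
    obtain ⟨s₁, rfl⟩ : ∃ n : ℕ, a = n := ⟨a.toNat, (Int.toNat_of_nonneg hs.1.1).symm⟩
    obtain ⟨s₂, rfl⟩ : ∃ n : ℕ, b = n := ⟨b.toNat, (Int.toNat_of_nonneg hs.2.1).symm⟩
    apply Subtype.ext
    have h1 : s₁ < m := by exact_mod_cast hs.1.2
    have h2 : s₂ < m := by exact_mod_cast hs.2.2
    rw [hK s₁ s₂ h1 h2, shift_apply, Prod.mk_add_mk]
    have := hV 0 (K.1 + s₁) (K.2 + s₂) (by omega) (by omega)
    simp only [Prod.fst_zero, Prod.snd_zero, mul_zero, add_zero] at this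
    rw [← this]
    congr 2
    refine Prod.ext ?_ ?_ <;> push_cast <;> ring
  · intro t s hs
    rw [mem_square] at hs
    obtain ⟨a, b⟩ := s
    simp only at hs
    obtain ⟨s₁, rfl⟩ : ∃ n : ℕ, a = n := ⟨a.toNat, (Int.toNat_of_nonneg hs.1.1).symm⟩
    obtain ⟨s₂, rfl⟩ : ∃ n : ℕ, b = n := ⟨b.toNat, (Int.toNat_of_nonneg hs.2.1).symm⟩
    apply Subtype.ext
    have h1 : s₁ < m := by exact_mod_cast hs.1.2
    have h2 : s₂ < m := by exact_mod_cast hs.2.2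
    rw [hL s₁ s₂ h1 h2, shift_apply]
    have := hV t (L.1 + s₁) (L.2 + s₂) (by omega) (by omega)
    rw [← this]
    congr 2
    refine Prod.ext ?_ ?_ <;> simp only [Prod.fst_add, Prod.snd_add] <;> push_cast <;> ring

end Literature.Dynamics.Tilings.Ollinger
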